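import Literature.NumberTheory.LFunctions.CriticalLineTwoThirdsTraceProofs
import Literature.NumberTheory.LFunctions.WeilExplicitContinuous
import Literature.NumberTheory.LFunctions.WeilArchModulatedGrowth
import Literature.NumberTheory.LFunctions.ZetaZeroReciprocalSum
import HarnessLib

/-!
# RH-FREE — «nothing here bears on the truth of RH»: Alpöge–Furman 2026 (arXiv:2608.13637) §2.1 — the densities `μ, Π_X, P_X, ν_X`, Weil's explicit formula in the form (2.2) `Σ_ρ m_ρ F̂(γ_ρ) = ∫ F̂ ν_X`, and (2.11) for the entries of the compressed form `G̃ + Ẽ` — PROVED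

Topic `Literature/NumberTheory/LFunctions` (namespace `Literature.NumberTheory.LFunctions`, objects in
`AlpogeFurman2026`). Cell `rh-columns/lit`, unit `rh-lit-frontier-1` (gen 7). Source:

* **[AF26]** L. Alpöge, R. Furman, *More than two thirds of the zeros of the Riemann zeta function
  are simple and on the critical line*, arXiv:2608.13637v2 (19 Aug 2026). UNREFEREED preprint
  (D-0012). Locators = printed equation numbers and pages of v2.

This file contains NO new claim and NO `sorry`: four DEFINITIONS with bodies (the densities of
[AF26] §2.1) and theorems PROVED from the tree's Guinand–Weil explicit formula. It is the first
node of the prime-side evaluation of the compressed form (§5 of [AF26], whose end point, Theorem 5.7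
`‖G̃‖²_HS = (R(ψ)+O(L⁻¹)) N(T,2T)`, is the tree's one remaining independent claim of the source,
`AlpogeFurman2026_hilbertSchmidt` of `CriticalLineTwoThirdsMatrix.lean`): it moves the entries of
`G̃ + Ẽ` from the zeros to the line `Re s = ½`, where §5 of the source integrates them against `ν_X`.

## What the source prints (§2.1, pp. 3–4; §2.3, pp. 4–5)

* §2.1: for `τ ∈ ℝ`, `μ(τ) := (1/2π) Re Γ′/Γ(¼ + iτ/2) − (log π)/2π`,
  `Π_X(τ) := (1/π) Re (X^{½+iτ}/(½+iτ))`, `P_X(τ) := −(1/π) Σ_{n≤X} Λ(n) n^{−½} cos(τ log n)`, and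
  `ν_X := μ + Π_X + P_X`. Weil's explicit formula (2.1) for `F ∈ C²_c(ℝ)` even:
  `Σ_ρ m_ρ F̂(γ_ρ) = F̂(i/2) + F̂(−i/2) + ∫ F̂ μ − 2 Σ_n Λ(n) n^{−½} F(log n)`; and (2.2): if moreover
  `supp F ⊂ [−log X, log X]` then the pole terms are absorbed into `∫ F̂ · Π_X` and
  `Σ_ρ m_ρ F̂(γ_ρ) = ∫_ℝ F̂(τ) ν_X(τ) dτ`. (2.3)–(2.5): properties of `μ`, the bounds
  `|Π_X(τ)| ≤ 3√X/(1+|τ|)`, `|P_X(τ)| ≤ (1/π) Σ_{n≤X} Λ(n)/√n ≪ √X`, and the integrals of `μ`, `μ²`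
  over `[T, 2T]`. Here `f̂(ξ) = ∫ f(u) e^{−iuξ} du` (§1.7) and `γ_ρ = (ρ − ½)/i` (§1.2).
* §2.3 eq. (2.11): by (2.2), `(G̃ + Ẽ)_{kk′} = (aL²)⁻¹ ∫_ℝ φ̂(τ − α_k) φ̂(τ − α_{k′}) ν_X(τ) dτ`, where
  `G̃ + Ẽ = (aL²)⁻¹ Σ_{all ρ} m_ρ v_ρ v_ρᵀ`, `v_ρ = (φ̂(γ_ρ − α_k))_k` ((2.9)–(2.10)).

## What is proved here, and how

* §1 `archDensity = μ`, `polarKernel X τ = X^{½+iτ}/(½+iτ)` (as `e^{(½+iτ) log X}/(½+iτ)`),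
  `polarDensity = Π_X`, `primeDensity = P_X` (sum over `n ∈ range(⌊X⌋₊+1)`, i.e. `n ≤ X` for
  `X ≥ 0`), `weilDensity = ν_X`; continuity and the crude bounds `|μ(τ)| ≤ (log(3+|τ|)+12+log π)/2π`
  (tree: `abs_re_digamma_quarter_le_log`), `|Π_X| ≤ (2/π)√X`, `|P_X| ≤ (1/π)Σ_{n≤X}Λ(n)/√n`. The
  quantitative (2.3), (2.5) (Stirling for `μ`, `∫_T^{2T} μ = N(T,2T) + O(l)`) are NOT proved here
  (they belong with Proposition 5.3).
* §2 Mellin inversion on a vertical line for `g` merely CONTINUOUS of compact support whose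
  transform `y ↦ ĝ(c+iy)` is integrable (`weilMellin_inversion_of_integrable` and its consequences
  `…_half`, `…_half_neg`, `integral_weilMellin_half`, the cosine form
  `∫ ĝ(½+iy)·2cos(yt) dy = 2π(g(t)+g(−t))`, and the polar identity
  `∫ ĝ(c+iy)/(c+iy−a) dy = 2π ∫₀^∞ g e^{(a−½)x}`): the proofs of the tree's `WeilMellinInversion`
  (stated there for smooth tests) verbatim, with smoothness replaced by the integrability it served.
* §3 **(2.2) PROVED** in the tree's normalisation `ĝ(s) = ∫ g(t)e^{(s−½)t}dt` (so `ĝ(½+iτ)` is the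
  printed `F̂(τ)` for `F = g(−·)`, and `ĝ(ρ) = F̂(γ_ρ)`): `AlpogeFurman2026_explicit_formula_nu` — for
  `X ≥ 1`, `g` continuous with `supp g ⊆ [−log X, log X]`, absolutely convergent zero side and
  integrable `ĝ(½+i·)`, `ĝ(½+i·) Re ψ(¼+i·/2)`:
  `Σ_ρ m(ρ) ĝ(ρ) = ∫ ĝ(½+iτ) ν_X(τ) dτ` (sum over all non-trivial zeros, each once, `tsum`). Route:
  the tree's `explicit_formula_continuous` + `hasWeilZeroSide_tsum` give `Σ_ρ m ĝ(ρ) = W(g)`; then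
  term by term on the critical line: POLAR `ĝ(0) + ĝ(1) = ∫ ĝ(½+iy) Π_X(y) dy` (shift `g` by
  `log X`, `1/(½+iy) = ∫₀^∞ e^{−(½+iy)x}dx`, Fubini, inversion; the reflected kernel via `g(−·)`,
  `conj(X^{½+iy}/(½+iy)) = X^{½−iy}/(½−iy)`), PRIME `Σ_n Λ(n)n^{−½}(g(log n)+g(−log n)) = −∫ ĝ P_X`
  (only `n ≤ X` survive; cosine inversion at `t = log n`), ARCHIMEDEAN
  `(1/2π)∫ ĝ Re ψ − g(0) log π = ∫ ĝ μ` (`∫ ĝ(½+iy)dy = 2πg(0)`).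
* §4 the modulated windows `φ_α(t) = φ(t)e^{−iαt}` (`phiMod`; `(φ_α)^(s) = φ̂(γ_s − α)`,
  `weilMellin_phiMod`, by evenness of `φ` and `iγ_s = s − ½`) and the pair test functions
  `g_{α,α′} = φ_α ⋆ φ_{α′}` (`pairTest`; `ĝ_{α,α′}(s) = φ̂(γ_s − α) φ̂(γ_s − α′)` by the tree's
  `weilMellin_weilConv_holds`; `supp ⊆ [−L, L]`); the uniform decay
  `‖φ̂(ξ+iy)‖ ≤ D/(1+|ξ|)` for `|y| ≤ ½` (`exists_norm_hat_phi_le_strip`, from the tree's first-order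
  decay `norm_hat_phi_le` of `CriticalLineTwoThirdsTraceProofs` and the trivial bound), hence
  `‖φ̂(ξ−α+iy) φ̂(ξ−α′+iy)‖ ≤ K/(1+ξ²)`; with `Σ_ρ m(ρ)/(1+γ²) < ∞` (tree, `ZetaZeroReciprocalSum`) and
  `|Re ψ(¼+iy/2)| ≤ log(3+|y|)+12` (tree) this discharges the three analytic hypotheses for `g_{α,α′}`.
* §5 **(2.11) PROVED**: `AlpogeFurman2026_gram_entry_formula` — for a window `ψ`, `T ≥ 2π` with
  `L ≥ 10`, and all real `α, α′`,
  `Σ_ρ m_ρ φ̂(γ_ρ − α) φ̂(γ_ρ − α′) = ∫ φ̂(τ − α) φ̂(τ − α′) ν_X(τ) dτ`, `X = T/2π`; and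
  `gramMatrix_apply` (the entries of the typed `G̃` as the near-window part of that sum).

DEVIATIONS (recorded): the source takes `F` even and `C²`; the tree's formula needs neither (the
pair test function `φ_{α_k} ⋆ φ_{α_{k′}}` is not even, and only continuity + the decay of `φ̂` are
used). Only FIRST-order decay of `φ̂` is needed at this stage (absolute convergence of the zero side
against `Σ m/(1+γ²)`); the second-order decay of (2.8) enters later (Propositions 4.3, 5.2).

STATUS NOTE (no endorsement). [AF26] is an unrefereed preprint. The identities proved here are
classical (Weil 1952 / Bombieri 2000 explicit formula, evaluated on the critical line) and say
nothing about the truth of [AF26]'s Theorem 5.7 or Theorem A, nor about RH; they are unconditional.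

## References
* [AlpogeFurman2026] as above, §2.1 (pp. 3–4), eqs. (2.1)–(2.5), §2.3 eq. (2.11) (pp. 4–5).
* [Bombieri2000Weil] E. Bombieri, Rend. Mat. Acc. Lincei (9) 11 (2000), §2 (Mellin inversion on
  vertical lines; the polar terms) — via the tree's `WeilMellinInversion`, `WeilExplicitContinuous`.
-/

noncomputable section

open Complex Filter Set MeasureTheory
open scoped Real Topology ComplexConjugate FourierTransform

namespace Literature.NumberTheory.LFunctions

open scoped ArithmeticFunction.vonMangoldt

namespace AlpogeFurman2026

/-! ## §1. The densities `μ, Π_X, P_X, ν_X` of [AF26] §2.1 -/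

/-- **[AF26] §2.1 eq. (2.2), the archimedean density**
`μ(τ) := (1/2π) Re Γ′/Γ(¼ + iτ/2) − (log π)/2π`. [cite: AlpogeFurman2026, §2.1, display before (2.1) (pp. 3–4)] -/
def archDensity (τ : ℝ) : ℝ :=
  1 / (2 * π) * (Complex.digamma (1 / 4 + τ / 2 * I)).re - Real.log π / (2 * π)

/-- The complex number `X^{½+iτ}/(½+iτ) = e^{(½+iτ) log X}/(½+iτ)` whose real part enters `Π_X`.
[cite: AlpogeFurman2026, §2.1, display before (2.1) (pp. 3–4)] -/
def polarKernel (X τ : ℝ) : ℂ :=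
  cexp ((1 / 2 + τ * I) * (Real.log X : ℂ)) / (1 / 2 + τ * I)

/-- **[AF26] §2.1 eq. (2.2), the polar density** `Π_X(τ) := (1/π) Re (X^{½+iτ}/(½+iτ))`
(`X^{s} = e^{s log X}`, `X > 0`). [cite: AlpogeFurman2026, §2.1, display before (2.1) (pp. 3–4)] -/
def polarDensity (X τ : ℝ) : ℝ :=
  1 / π * (polarKernel X τ).re

/-- **[AF26] §2.1 eq. (2.2), the prime density (a Dirichlet polynomial of length `X`)**
`P_X(τ) := −(1/π) Σ_{n ≤ X} Λ(n) n^{−1/2} cos(τ log n)`. [cite: AlpogeFurman2026, §2.1, display before (2.1) (pp. 3–4)] -/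
def primeDensity (X τ : ℝ) : ℝ :=
  -(1 / π) * ∑ n ∈ Finset.range (⌊X⌋₊ + 1), (Λ n : ℝ) / Real.sqrt n * Real.cos (τ * Real.log n)

/-- **[AF26] §2.1, the total density** `ν_X := μ + Π_X + P_X` of the explicit formula (2.3).
[cite: AlpogeFurman2026, §2.1 (pp. 3–4)] -/
def weilDensity (X τ : ℝ) : ℝ :=
  archDensity τ + polarDensity X τ + primeDensity X τ

/-! ### Cheap API -/

/-- Unfolding `ν_X`. [cite: AlpogeFurman2026, §2.1 (pp. 3–4)] -/
theorem weilDensity_def (X τ : ℝ) :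
    weilDensity X τ = archDensity τ + polarDensity X τ + primeDensity X τ := rfl

/-- `μ` is continuous. [cite: AlpogeFurman2026, §2.1 eq. (2.3) (p. 4)] -/
theorem continuous_archDensity : Continuous archDensity := by
  unfold archDensity
  exact (continuous_const.mul continuous_re_digamma_quarter_half).sub continuous_const

/-- `|μ(τ)| ≤ (log(3 + |τ|) + 12)/(2π) + (log π)/(2π)` — a crude form of (2.4)
`μ(τ) = (1/2π) log(|τ|/2π) + O(τ⁻²)`. [cite: AlpogeFurman2026, §2.1 eq. (2.3) (p. 4)] -/
theorem abs_archDensity_le (τ : ℝ) :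
    |archDensity τ| ≤ (Real.log (3 + |τ|) + 12) / (2 * π) + Real.log π / (2 * π) := by
  have hπ := Real.pi_gt_three
  have h := abs_re_digamma_quarter_le_log τ
  unfold archDensity
  have hlogπ : 0 ≤ Real.log π := Real.log_nonneg (by linarith)
  calc |1 / (2 * π) * (digamma (1 / 4 + τ / 2 * I)).re - Real.log π / (2 * π)|
      ≤ |1 / (2 * π) * (digamma (1 / 4 + τ / 2 * I)).re| + |Real.log π / (2 * π)| := abs_sub _ _
    _ = 1 / (2 * π) * |(digamma (1 / 4 + τ / 2 * I)).re| + Real.log π / (2 * π) := by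
        rw [abs_mul, abs_of_pos (by positivity : (0 : ℝ) < 1 / (2 * π)),
          abs_of_nonneg (div_nonneg hlogπ (by positivity))]
    _ ≤ 1 / (2 * π) * (Real.log (3 + |τ|) + 12) + Real.log π / (2 * π) := by
        gcongr
    _ = (Real.log (3 + |τ|) + 12) / (2 * π) + Real.log π / (2 * π) := by ring

/-- The denominator `½ + iτ` never vanishes. [cite: AlpogeFurman2026, §2.1 (pp. 3–4)] -/
theorem half_add_mul_I_ne_zero (τ : ℝ) : (1 / 2 : ℂ) + τ * I ≠ 0 := by
  intro h
  have := congrArg Complex.re h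
  simp at this

/-- `‖X^{½+iτ}/(½+iτ)‖ ≤ 2√X` for `X ≥ 1`… in the form `≤ 2 e^{(log X)/2}`.
[cite: AlpogeFurman2026, §2.1 eq. (2.4) (p. 4)] -/
theorem norm_polarKernel_le (X τ : ℝ) : ‖polarKernel X τ‖ ≤ 2 * Real.exp (Real.log X / 2) := by
  unfold polarKernel
  rw [norm_div, Complex.norm_exp]
  have hre : ((1 / 2 + τ * I) * (Real.log X : ℂ)).re = Real.log X / 2 := by
    simp [Complex.mul_re]; ring
  rw [hre]
  have hden : (1 / 2 : ℝ) ≤ ‖(1 / 2 : ℂ) + τ * I‖ := by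
    have h := Complex.abs_re_le_norm ((1 / 2 : ℂ) + τ * I)
    norm_num at h ⊢
    exact h
  rw [div_le_iff₀ (by linarith)]
  nlinarith [Real.exp_pos (Real.log X / 2)]

/-- `Π_X` is continuous in `τ`. [cite: AlpogeFurman2026, §2.1 (pp. 3–4)] -/
theorem continuous_polarKernel (X : ℝ) : Continuous (polarKernel X) := by
  unfold polarKernel
  exact Continuous.div (by fun_prop) (by fun_prop) half_add_mul_I_ne_zero

/-- `Π_X` is continuous. [cite: AlpogeFurman2026, §2.1 (pp. 3–4)] -/
theorem continuous_polarDensity (X : ℝ) : Continuous (polarDensity X) := by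
  unfold polarDensity
  exact continuous_const.mul (Complex.continuous_re.comp (continuous_polarKernel X))

/-- `|Π_X(τ)| ≤ (2/π) e^{(log X)/2}` (the printed (2.4) has `3√X/(1+|τ|)`; this crude form is all the
identity below needs). [cite: AlpogeFurman2026, §2.1 eq. (2.4) (p. 4)] -/
theorem abs_polarDensity_le (X τ : ℝ) : |polarDensity X τ| ≤ 2 / π * Real.exp (Real.log X / 2) := by
  have hπ := Real.pi_gt_three
  unfold polarDensity
  rw [abs_mul, abs_of_pos (by positivity : (0 : ℝ) < 1 / π)]
  have := (Complex.abs_re_le_norm _).trans (norm_polarKernel_le X τ)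
  calc 1 / π * |(polarKernel X τ).re| ≤ 1 / π * (2 * Real.exp (Real.log X / 2)) := by gcongr
    _ = 2 / π * Real.exp (Real.log X / 2) := by ring

/-- `P_X` is continuous in `τ`. [cite: AlpogeFurman2026, §2.1 (pp. 3–4)] -/
theorem continuous_primeDensity (X : ℝ) : Continuous (primeDensity X) := by
  unfold primeDensity
  refine continuous_const.mul (continuous_finsetSum _ fun n _ ↦ ?_)
  fun_prop

/-- `|P_X(τ)| ≤ (1/π) Σ_{n≤X} Λ(n)/√n` (the first half of the printed (2.4)). [cite: AlpogeFurman2026, §2.1 eq. (2.4) (p. 4)] -/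
theorem abs_primeDensity_le (X τ : ℝ) :
    |primeDensity X τ| ≤ 1 / π * ∑ n ∈ Finset.range (⌊X⌋₊ + 1), (Λ n : ℝ) / Real.sqrt n := by
  have hπ := Real.pi_gt_three
  unfold primeDensity
  rw [abs_mul, abs_neg, abs_of_pos (by positivity : (0 : ℝ) < 1 / π)]
  gcongr
  refine (Finset.abs_sum_le_sum_abs _ _).trans (Finset.sum_le_sum fun n _ ↦ ?_)
  rw [abs_mul]
  have h1 : 0 ≤ (Λ n : ℝ) / Real.sqrt n :=
    div_nonneg ArithmeticFunction.vonMangoldt_nonneg (Real.sqrt_nonneg _)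
  rw [abs_of_nonneg h1]
  exact mul_le_of_le_one_right h1 (Real.abs_cos_le_one _)

/-- `ν_X` is continuous. [cite: AlpogeFurman2026, §2.1 (pp. 3–4)] -/
theorem continuous_weilDensity (X : ℝ) : Continuous (weilDensity X) :=
  (continuous_archDensity.add (continuous_polarDensity X)).add (continuous_primeDensity X)

end AlpogeFurman2026

/-! ## §2. Mellin inversion on a vertical line for continuous `g` with integrable transform -/

namespace AlpogeFurman2026

variable {g : ℝ → ℂ}

/-- Mellin inversion `∫ ĝ(c + iy) e^{−iyt} dy = 2π g(t) e^{(c−½)t}` for `g` continuous of compact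
support whose transform is integrable on the line `Re s = c` (the tree's `weilMellin_inversion`,
with smoothness replaced by the integrability it was used for). [cite: Bombieri2000Weil, §2] -/
theorem weilMellin_inversion_of_integrable (hgc : Continuous g) (hgs : HasCompactSupport g) {c : ℝ}
    (hI : Integrable fun y : ℝ ↦ weilMellin g (c + y * I)) (t : ℝ) :
    ∫ y : ℝ, weilMellin g (c + y * I) * cexp (-(y * I) * t) =
      2 * π * (g t * cexp ((c - 1 / 2 : ℂ) * t)) := by
  set G : ℝ → ℂ := fun t ↦ g t * cexp ((c - 1 / 2 : ℂ) * t) with hG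
  have hGc : Continuous G := by rw [hG]; fun_prop
  have hGi : Integrable G := hGc.integrable_of_hasCompactSupport hgs.mul_right
  have hFG : 𝓕 G = fun w : ℝ ↦ weilMellin g (c + ((-(2 * π * w) : ℝ) : ℂ) * I) :=
    funext (fourier_weilKernel g c)
  have hFGi : Integrable (𝓕 G) := by
    rw [hFG]
    have h := hI.comp_mul_left' (R := -(2 * π)) (neg_ne_zero.2 (by positivity))
    refine h.congr (Eventually.of_forall fun w ↦ ?_)
    simp only
    congr 3
    push_cast
    ring
  have hinv := hGi.fourierInv_fourier_eq hFGi (hGc.continuousAt (x := t))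
  rw [Real.fourierInv_eq', hFG] at hinv
  simp only [Real.inner_apply, smul_eq_mul] at hinv
  have hsub := Measure.integral_comp_mul_left
    (fun y : ℝ ↦ weilMellin g (c + y * I) * cexp (-(y * I) * t)) (-(2 * π))
  have hH : (fun w : ℝ ↦ (fun y : ℝ ↦ weilMellin g (c + y * I) * cexp (-(y * I) * t))
      (-(2 * π) * w)) = fun w : ℝ ↦ cexp (((2 * π * (w * t) : ℝ) : ℂ) * I) *
        weilMellin g (c + ((-(2 * π * w) : ℝ) : ℂ) * I) := by
    funext w
    simp only
    rw [mul_comm]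
    congr 1
    · congr 1
      push_cast
      ring
    · congr 1
      push_cast
      ring
  rw [hH, hinv] at hsub
  have hpi : |(-(2 * π))⁻¹| = (2 * π)⁻¹ := by
    rw [inv_neg, abs_neg, abs_of_pos (by positivity)]
  rw [hpi] at hsub
  have key : (∫ y : ℝ, weilMellin g (c + y * I) * cexp (-(y * I) * t)) =
      ((2 * π : ℝ) : ℂ) * G t := by
    rw [hsub, Complex.real_smul, ← mul_assoc]
    push_cast
    rw [mul_inv_cancel₀ (mul_ne_zero two_ne_zero (Complex.ofReal_ne_zero.2 Real.pi_ne_zero)),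
      one_mul]
  rw [key, hG]
  push_cast
  ring

/-- On the critical line: `∫ ĝ(½ + iy) e^{−iyt} dy = 2π g(t)`. [cite: Bombieri2000Weil, §2] -/
theorem weilMellin_inversion_half (hgc : Continuous g) (hgs : HasCompactSupport g)
    (hI : Integrable fun y : ℝ ↦ weilMellin g (1 / 2 + y * I)) (t : ℝ) :
    ∫ y : ℝ, weilMellin g (1 / 2 + y * I) * cexp (-(y * I) * t) = 2 * π * g t := by
  have h := weilMellin_inversion_of_integrable hgc hgs (c := 1 / 2) (by simpa using hI) t
  simpa using h

/-- Reflected form: `∫ ĝ(½ + iy) e^{+iyt} dy = 2π g(−t)` (inversion for `g(−·)`, whose transform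
is `ĝ(1 − s)`). [cite: Bombieri2000Weil, §2] -/
theorem weilMellin_inversion_half_neg (hgc : Continuous g) (hgs : HasCompactSupport g)
    (hI : Integrable fun y : ℝ ↦ weilMellin g (1 / 2 + y * I)) (t : ℝ) :
    ∫ y : ℝ, weilMellin g (1 / 2 + y * I) * cexp ((y * I) * t) = 2 * π * g (-t) := by
  set h : ℝ → ℂ := fun u ↦ g (-u) with hh
  have hhc : Continuous h := hgc.comp continuous_neg
  have hhs : HasCompactSupport h := hgs.comp_homeomorph (Homeomorph.neg ℝ)
  have hmel : ∀ y : ℝ, weilMellin h (1 / 2 + y * I) = weilMellin g (1 / 2 + (-y : ℝ) * I) := by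
    intro y
    rw [hh, weilMellin_comp_neg]
    congr 1
    push_cast
    ring
  have hIh : Integrable fun y : ℝ ↦ weilMellin h (1 / 2 + y * I) := by
    simp_rw [hmel]
    exact hI.comp_neg
  have hinv := weilMellin_inversion_half hhc hhs hIh t
  simp_rw [hmel] at hinv
  rw [← integral_neg_eq_self] at hinv
  simp only [neg_neg] at hinv
  rw [← hinv]
  congr 1 with y
  congr 1
  · congr 1; push_cast; ring

/-- `∫ ĝ(½ + iy) dy = 2π g(0)`. [cite: Bombieri2000Weil, §2 eq. (2.2)] -/
theorem integral_weilMellin_half (hgc : Continuous g) (hgs : HasCompactSupport g)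
    (hI : Integrable fun y : ℝ ↦ weilMellin g (1 / 2 + y * I)) :
    ∫ y : ℝ, weilMellin g (1 / 2 + y * I) = 2 * π * g 0 := by
  have h := weilMellin_inversion_half hgc hgs hI 0
  simpa using h

/-- **The cosine inversion formula**: `∫ ĝ(½ + iy) · 2cos(yt) dy = 2π (g(t) + g(−t))`. [cite: Bombieri2000Weil, §2 eq. (2.2)] -/
theorem integral_weilMellin_half_mul_cos (hgc : Continuous g) (hgs : HasCompactSupport g)
    (hI : Integrable fun y : ℝ ↦ weilMellin g (1 / 2 + y * I)) (t : ℝ) :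
    ∫ y : ℝ, weilMellin g (1 / 2 + y * I) * (2 * Real.cos (y * t) : ℝ) =
      2 * π * (g t + g (-t)) := by
  have h1 := weilMellin_inversion_half hgc hgs hI t
  have h2 := weilMellin_inversion_half_neg hgc hgs hI t
  have hi1 : Integrable fun y : ℝ ↦ weilMellin g (1 / 2 + y * I) * cexp (-(y * I) * t) := by
    refine hI.mul_bdd (c := 1) ?_ (Eventually.of_forall fun y ↦ ?_)
    · exact (by fun_prop : Continuous fun y : ℝ ↦ cexp (-(y * I) * t)).aestronglyMeasurable
    · rw [Complex.norm_exp]; simp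
  have hi2 : Integrable fun y : ℝ ↦ weilMellin g (1 / 2 + y * I) * cexp ((y * I) * t) := by
    refine hI.mul_bdd (c := 1) ?_ (Eventually.of_forall fun y ↦ ?_)
    · exact (by fun_prop : Continuous fun y : ℝ ↦ cexp ((y * I) * t)).aestronglyMeasurable
    · rw [Complex.norm_exp]; simp
  have hcos : ∀ y : ℝ, ((2 * Real.cos (y * t) : ℝ) : ℂ) = cexp (-(y * I) * t) + cexp ((y * I) * t) := by
    intro y
    rw [show -(y * I : ℂ) * t = -(((y * t : ℝ)) : ℂ) * I by push_cast; ring,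
      show (y * I : ℂ) * t = (((y * t : ℝ)) : ℂ) * I by push_cast; ring]
    push_cast
    rw [Complex.two_cos, add_comm]
  simp_rw [hcos, mul_add]
  rw [integral_add hi1 hi2, h1, h2]


/-- Mellin inversion, second form: `∫ ĝ(c + iy) e^{-(c - ½ + iy)t} dy = 2π g(t)`. [cite: Bombieri2000Weil, §2] -/
theorem weilMellin_inversion_of_integrable' (hgc : Continuous g) (hgs : HasCompactSupport g) {c : ℝ}
    (hI : Integrable fun y : ℝ ↦ weilMellin g (c + y * I)) (t : ℝ) :
    ∫ y : ℝ, weilMellin g (c + y * I) * cexp (-((c - 1 / 2 : ℂ) + y * I) * t) = 2 * π * g t := by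
  have e : ∀ y : ℝ, weilMellin g (c + y * I) * cexp (-((c - 1 / 2 : ℂ) + y * I) * t) =
      weilMellin g (c + y * I) * cexp (-(y * I) * t) * cexp (-(c - 1 / 2 : ℂ) * t) := by
    intro y
    rw [mul_assoc, ← Complex.exp_add]
    congr 2
    ring
  simp_rw [e]
  rw [integral_mul_const, weilMellin_inversion_of_integrable hgc hgs hI t]
  have : (c - 1 / 2 : ℂ) * t + -(c - 1 / 2 : ℂ) * t = 0 := by ring
  calc 2 * (π : ℂ) * (g t * cexp ((c - 1 / 2 : ℂ) * t)) * cexp (-(c - 1 / 2 : ℂ) * t)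
      = 2 * π * g t * (cexp ((c - 1 / 2 : ℂ) * t) * cexp (-(c - 1 / 2 : ℂ) * t)) := by ring
    _ = 2 * π * g t := by rw [← Complex.exp_add, this, Complex.exp_zero, mul_one]

/-- The polar-term identity on a vertical line: for `Re a < c`,
`∫ ĝ(c + iy)/(c + iy − a) dy = 2π ∫₀^∞ g(x) e^{(a − ½)x} dx` (the tree's
`integral_weilMellin_vertical_div_sub`, smoothness replaced by integrability on the line). [cite: Bombieri2000Weil, §2 eq. (2.3)] -/
theorem integral_weilMellin_vertical_div_sub_of_integrable (hgc : Continuous g)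
    (hgs : HasCompactSupport g) {c : ℝ} (hI : Integrable fun y : ℝ ↦ weilMellin g (c + y * I))
    {a : ℂ} (hac : a.re < c) :
    ∫ y : ℝ, weilMellin g (c + y * I) / (c + y * I - a) =
      2 * π * ∫ x in Ioi (0 : ℝ), g x * cexp ((a - 1 / 2) * x) := by
  -- Step 1: `1/(s - a) = ∫₀^∞ e^{(a - s)x} dx` on the line.
  have hrep : ∀ y : ℝ, (c + y * I - a)⁻¹ =
      ∫ x in Ioi (0 : ℝ), cexp ((a - (c + y * I)) * x) := by
    intro y
    have hre : (a - (c + y * I)).re < 0 := by simp; linarith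
    rw [integral_exp_mul_complex_Ioi hre 0]
    simp only [Complex.ofReal_zero, mul_zero, Complex.exp_zero]
    rw [neg_div, ← div_neg, one_div, neg_sub]
  have step1 : (fun y : ℝ ↦ weilMellin g (c + y * I) / (c + y * I - a)) =
      fun y : ℝ ↦ ∫ x in Ioi (0 : ℝ), weilMellin g (c + y * I) * cexp ((a - (c + y * I)) * x) := by
    funext y
    rw [div_eq_mul_inv, hrep y, ← integral_const_mul]
  rw [step1]
  -- Step 2: Fubini.
  have hint : Integrable (Function.uncurry fun (y : ℝ) (x : ℝ) ↦
      weilMellin g (c + y * I) * cexp ((a - (c + y * I)) * x))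
      ((volume : Measure ℝ).prod (volume.restrict (Ioi (0 : ℝ)))) := by
    have h2 : Integrable (fun x : ℝ ↦ cexp ((a - c) * x)) (volume.restrict (Ioi (0 : ℝ))) :=
      integrableOn_exp_mul_complex_Ioi (by simp; linarith) 0
    refine Integrable.mono' (hI.mul_prod h2).norm ?_ (Eventually.of_forall fun p ↦ ?_)
    · have hcont : Continuous (weilMellin g) := continuous_weilMellin hgc hgs
      exact (by fun_prop : Continuous (Function.uncurry fun (y : ℝ) (x : ℝ) ↦
        weilMellin g (c + y * I) * cexp ((a - (c + y * I)) * x))).aestronglyMeasurable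
    · obtain ⟨y, x⟩ := p
      simp only [Function.uncurry_apply_pair, norm_mul, Complex.norm_exp]
      refine le_of_eq ?_
      congr 2
      simp [sub_re, mul_re]
  rw [integral_integral_swap hint]
  -- Step 3: inner integral by Mellin inversion.
  have inner : ∀ x : ℝ, (∫ y : ℝ, weilMellin g (c + y * I) * cexp ((a - (c + y * I)) * x)) =
      cexp ((a - 1 / 2) * x) * (2 * π * g x) := by
    intro x
    rw [← weilMellin_inversion_of_integrable' hgc hgs hI x, ← integral_const_mul]
    congr 1 with y
    rw [mul_left_comm, ← Complex.exp_add]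
    congr 2
    ring
  simp_rw [inner]
  rw [← integral_const_mul]
  congr 1 with x
  ring

/-! ## §3. The explicit formula with the density `ν_X` ([AF26] (2.2)) -/

/-- Shifting the test function multiplies the transform by an exponential:
`(g(· − L))^(s) = e^{(s−½)L} ĝ(s)`. [cite: Bombieri2000Weil, §2] -/
theorem weilMellin_comp_sub (g : ℝ → ℂ) (L : ℝ) (s : ℂ) :
    weilMellin (fun t ↦ g (t - L)) s = cexp ((s - 1 / 2) * L) * weilMellin g s := by
  unfold weilMellin
  rw [← integral_const_mul]
  have h := integral_sub_right_eq_self (μ := (volume : Measure ℝ))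
    (fun u : ℝ ↦ g u * cexp ((s - 1 / 2) * ((u + L : ℝ) : ℂ))) L
  simp only [sub_add_cancel] at h
  -- h : ∫ g (x - L) * cexp ((s-1/2) x) = ∫ g x * cexp ((s-1/2) (x+L))
  change (∫ t : ℝ, g (t - L) * cexp ((s - 1 / 2) * (t : ℂ))) = _
  rw [h]
  congr 1 with t
  rw [mul_left_comm, ← Complex.exp_add]
  congr 2
  push_cast
  ring

/-- `conj (X^{½+iy}/(½+iy)) = X^{½−iy}/(½−iy)`. [cite: AlpogeFurman2026, §2.1 (pp. 3–4)] -/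
theorem conj_polarKernel (X y : ℝ) : conj (polarKernel X y) = polarKernel X (-y) := by
  unfold polarKernel
  rw [map_div₀, ← Complex.exp_conj]
  congr 1
  · congr 1
    simp only [map_mul, map_add, Complex.conj_ofReal, Complex.conj_I, map_one, map_div₀,
      map_ofNat, Complex.ofReal_neg]
    ring
  · simp only [map_add, Complex.conj_ofReal, Complex.conj_I, map_one, map_div₀, map_ofNat,
      map_mul, Complex.ofReal_neg]
    ring

/-- `Π_X` as a complex number: `Π_X(y) = (1/2π)(K + K̄)`, `K = X^{½+iy}/(½+iy)`. [cite: AlpogeFurman2026, §2.1 (pp. 3–4)] -/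
theorem polarDensity_eq (X y : ℝ) :
    ((polarDensity X y : ℝ) : ℂ) = 1 / (2 * π) * (polarKernel X y + polarKernel X (-y)) := by
  rw [← conj_polarKernel, Complex.add_conj, polarDensity]
  push_cast
  ring

/-- **The polar term on the critical line**: if `g` vanishes below `−log X` then
`∫ ĝ(½+iy) X^{½+iy}/(½+iy) dy = 2π ĝ(0)` (shift by `log X`, `1/(½+iy) = ∫₀^∞ e^{−(½+iy)x}dx`,
Fubini and Mellin inversion — [AF26] §2.1: "the pole terms `F̂(±i/2)` are absorbed into
`∫ F̂ · Π_X`" when `supp F ⊂ [−log X, log X]`). [cite: AlpogeFurman2026, §2.1 eq. (2.2) (p. 4)] -/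
theorem integral_weilMellin_half_mul_polarKernel (hgc : Continuous g) (hgs : HasCompactSupport g)
    (hI : Integrable fun y : ℝ ↦ weilMellin g (1 / 2 + y * I)) {X : ℝ}
    (hvan : ∀ u : ℝ, u < -Real.log X → g u = 0) :
    ∫ y : ℝ, weilMellin g (1 / 2 + y * I) * polarKernel X y = 2 * π * weilMellin g 0 := by
  set L : ℝ := Real.log X with hL
  set gL : ℝ → ℂ := fun t ↦ g (t - L) with hgL
  have hgLc : Continuous gL := hgc.comp (continuous_id.sub continuous_const)
  have hgLs : HasCompactSupport gL := hgs.comp_homeomorph (Homeomorph.subRight L)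
  have hmel : ∀ s : ℂ, weilMellin gL s = cexp ((s - 1 / 2) * L) * weilMellin g s :=
    fun s ↦ weilMellin_comp_sub g L s
  have hIL : Integrable fun y : ℝ ↦ weilMellin gL (1 / 2 + y * I) := by
    simp_rw [hmel]
    refine hI.bdd_mul (c := 1) (by fun_prop) (Eventually.of_forall fun y ↦ ?_)
    rw [Complex.norm_exp]
    simp
  -- the identity for `gL` with `a = 0`
  have hkey := integral_weilMellin_vertical_div_sub_of_integrable hgLc hgLs (c := 1 / 2) (a := 0)
    (by simpa using hIL) (by simp)
  -- rewrite its left side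
  have hlhs : (∫ y : ℝ, weilMellin gL (((1 / 2 : ℝ) : ℂ) + y * I) / (((1 / 2 : ℝ) : ℂ) + y * I - 0)) =
      cexp (-(L / 2 : ℂ)) * ∫ y : ℝ, weilMellin g (1 / 2 + y * I) * polarKernel X y := by
    rw [← integral_const_mul]
    congr 1 with y
    push_cast
    rw [sub_zero, hmel, polarKernel, ← hL]
    have e : cexp ((1 / 2 + (y : ℂ) * I - 1 / 2) * (L : ℂ)) =
        cexp (-(L / 2 : ℂ)) * cexp ((1 / 2 + (y : ℂ) * I) * (L : ℂ)) := by
      rw [← Complex.exp_add]; congr 1; ring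
    rw [e]
    ring
  -- rewrite its right side
  have hrhs : (∫ x in Ioi (0 : ℝ), gL x * cexp (((0 : ℂ) - 1 / 2) * x)) =
      cexp (-(L / 2 : ℂ)) * weilMellin g 0 := by
    rw [← integral_Ici_eq_integral_Ioi, setIntegral_eq_integral_of_forall_compl_eq_zero]
    · have h0 := hmel 0
      unfold weilMellin at h0 ⊢
      rw [h0]
      congr 1
      congr 1
      ring
    · intro x hx
      rw [mem_Ici, not_le] at hx
      have : gL x = 0 := hvan _ (by linarith)
      rw [this, zero_mul]
  rw [hlhs, hrhs] at hkey
  have hexp : cexp (-(L / 2 : ℂ)) ≠ 0 := Complex.exp_ne_zero _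
  exact mul_left_cancel₀ hexp (hkey.trans (by ring :
    2 * (π : ℂ) * (cexp (-(L / 2 : ℂ)) * weilMellin g 0) = cexp (-(L / 2 : ℂ)) * (2 * π * weilMellin g 0)))

/-- **Reflected polar term**: if `g` vanishes above `log X` then
`∫ ĝ(½+iy) X^{½−iy}/(½−iy) dy = 2π ĝ(1)` (the previous identity for `g(−·)`, whose transform is
`ĝ(1 − s)`). [cite: AlpogeFurman2026, §2.1 eq. (2.2) (p. 4)] -/
theorem integral_weilMellin_half_mul_polarKernel_neg (hgc : Continuous g) (hgs : HasCompactSupport g)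
    (hI : Integrable fun y : ℝ ↦ weilMellin g (1 / 2 + y * I)) {X : ℝ}
    (hvan : ∀ u : ℝ, Real.log X < u → g u = 0) :
    ∫ y : ℝ, weilMellin g (1 / 2 + y * I) * polarKernel X (-y) = 2 * π * weilMellin g 1 := by
  set h : ℝ → ℂ := fun u ↦ g (-u) with hh
  have hhc : Continuous h := hgc.comp continuous_neg
  have hhs : HasCompactSupport h := hgs.comp_homeomorph (Homeomorph.neg ℝ)
  have hmel : ∀ y : ℝ, weilMellin h (1 / 2 + y * I) = weilMellin g (1 / 2 + (-y : ℝ) * I) := by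
    intro y
    rw [hh, weilMellin_comp_neg]
    congr 1
    push_cast
    ring
  have hIh : Integrable fun y : ℝ ↦ weilMellin h (1 / 2 + y * I) := by
    simp_rw [hmel]
    exact hI.comp_neg
  have hvan' : ∀ u : ℝ, u < -Real.log X → h u = 0 := fun u hu ↦ hvan _ (by linarith)
  have key := integral_weilMellin_half_mul_polarKernel hhc hhs hIh hvan'
  have h0 : weilMellin h 0 = weilMellin g 1 := by rw [hh, weilMellin_comp_neg, sub_zero]
  rw [h0] at key
  simp_rw [hmel] at key
  rw [← key]
  calc (∫ y : ℝ, weilMellin g (1 / 2 + y * I) * polarKernel X (-y))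
      = ∫ y : ℝ, (fun u : ℝ ↦ weilMellin g (1 / 2 + ((-u : ℝ) : ℂ) * I) * polarKernel X u) (-y) := by
        congr 1 with y
        simp only [neg_neg]
    _ = ∫ u : ℝ, weilMellin g (1 / 2 + ((-u : ℝ) : ℂ) * I) * polarKernel X u :=
        integral_neg_eq_self (fun u : ℝ ↦ weilMellin g (1 / 2 + ((-u : ℝ) : ℂ) * I) * polarKernel X u)
          volume

/-- **The polar term is `∫ ĝ Π_X`** for `g` supported in `[−log X, log X]`:
`ĝ(0) + ĝ(1) = ∫ ĝ(½+iy) Π_X(y) dy`. [cite: AlpogeFurman2026, §2.1 eq. (2.2) (p. 4)] -/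
theorem weilPolarTerm_eq_integral (hgc : Continuous g) (hgs : HasCompactSupport g)
    (hI : Integrable fun y : ℝ ↦ weilMellin g (1 / 2 + y * I)) {X : ℝ}
    (hvan₁ : ∀ u : ℝ, u < -Real.log X → g u = 0) (hvan₂ : ∀ u : ℝ, Real.log X < u → g u = 0) :
    weilPolarTerm g = ∫ y : ℝ, weilMellin g (1 / 2 + y * I) * ((polarDensity X y : ℝ) : ℂ) := by
  have h1 := integral_weilMellin_half_mul_polarKernel hgc hgs hI hvan₁
  have h2 := integral_weilMellin_half_mul_polarKernel_neg hgc hgs hI hvan₂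
  have hb : ∀ y : ℝ, ‖polarKernel X y‖ ≤ 2 * Real.exp (Real.log X / 2) := norm_polarKernel_le X
  have hi1 : Integrable fun y : ℝ ↦ weilMellin g (1 / 2 + y * I) * polarKernel X y :=
    hI.mul_bdd (continuous_polarKernel X).aestronglyMeasurable (Eventually.of_forall hb)
  have hi2 : Integrable fun y : ℝ ↦ weilMellin g (1 / 2 + y * I) * polarKernel X (-y) :=
    hI.mul_bdd ((continuous_polarKernel X).comp continuous_neg).aestronglyMeasurable
      (Eventually.of_forall fun y ↦ hb (-y))
  have e : ∀ y : ℝ, weilMellin g (1 / 2 + y * I) * ((polarDensity X y : ℝ) : ℂ) =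
      (1 / (2 * π) : ℂ) * (weilMellin g (1 / 2 + y * I) * polarKernel X y +
        weilMellin g (1 / 2 + y * I) * polarKernel X (-y)) := by
    intro y; rw [polarDensity_eq]; ring
  simp_rw [e]
  rw [integral_const_mul, integral_add hi1 hi2, h1, h2, weilPolarTerm]
  have hπ : (π : ℂ) ≠ 0 := Complex.ofReal_ne_zero.2 Real.pi_ne_zero
  field_simp

/-- Cosine form of the inversion formula: `∫ ĝ(½+iy) cos(yt) dy = π (g(t) + g(−t))`. [cite: Bombieri2000Weil, §2 eq. (2.2)] -/
theorem integral_weilMellin_half_mul_cos' (hgc : Continuous g) (hgs : HasCompactSupport g)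
    (hI : Integrable fun y : ℝ ↦ weilMellin g (1 / 2 + y * I)) (t : ℝ) :
    ∫ y : ℝ, weilMellin g (1 / 2 + y * I) * ((Real.cos (y * t) : ℝ) : ℂ) = π * (g t + g (-t)) := by
  have h := integral_weilMellin_half_mul_cos hgc hgs hI t
  have e : ∀ y : ℝ, weilMellin g (1 / 2 + y * I) * ((2 * Real.cos (y * t) : ℝ) : ℂ) =
      2 * (weilMellin g (1 / 2 + y * I) * ((Real.cos (y * t) : ℝ) : ℂ)) := by
    intro y; push_cast; ring
  simp_rw [e] at h
  rw [integral_const_mul] at h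
  have := mul_left_cancel₀ (two_ne_zero : (2 : ℂ) ≠ 0) (h.trans (by ring :
    2 * (π : ℂ) * (g t + g (-t)) = 2 * (π * (g t + g (-t)))))
  exact this

/-- **The prime term is `−∫ ĝ P_X`** for `g` supported in `[−log X, log X]` (`X ≥ 1`): only
`n ≤ X` contribute, and `Λ(n)n^{−½}(g(log n) + g(−log n)) = (Λ(n)/π√n) ∫ ĝ(½+iy) cos(y log n) dy`.
[cite: AlpogeFurman2026, §2.1 eq. (2.2) (p. 4)] -/
theorem weilPrimeTerm_eq_integral (hgc : Continuous g) (hgs : HasCompactSupport g)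
    (hI : Integrable fun y : ℝ ↦ weilMellin g (1 / 2 + y * I)) {X : ℝ} (hX : 1 ≤ X)
    (hvan₁ : ∀ u : ℝ, u < -Real.log X → g u = 0) (hvan₂ : ∀ u : ℝ, Real.log X < u → g u = 0) :
    weilPrimeTerm g = -∫ y : ℝ, weilMellin g (1 / 2 + y * I) * ((primeDensity X y : ℝ) : ℂ) := by
  have hπ0 : (π : ℂ) ≠ 0 := Complex.ofReal_ne_zero.2 Real.pi_ne_zero
  set s : Finset ℕ := Finset.range (⌊X⌋₊ + 1) with hs
  -- only `n ≤ X` contribute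
  have hzero : ∀ n ∉ s, ((Λ n : ℝ) : ℂ) / (Real.sqrt n : ℂ) * (g (Real.log n) + g (-Real.log n)) = 0 := by
    intro n hn
    rw [hs, Finset.mem_range, not_lt] at hn
    have hXn : X < n := lt_of_lt_of_le (Nat.lt_floor_add_one X) (by exact_mod_cast hn)
    have hlog : Real.log X < Real.log n := Real.log_lt_log (by linarith) hXn
    rw [hvan₂ _ hlog, hvan₁ _ (by linarith), add_zero, mul_zero]
  rw [weilPrimeTerm, tsum_eq_sum (s := s) (fun n hn ↦ hzero n hn)]
  -- each term by the cosine inversion formula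
  have hterm : ∀ n : ℕ, ((Λ n : ℝ) : ℂ) / (Real.sqrt n : ℂ) * (g (Real.log n) + g (-Real.log n)) =
      (((Λ n : ℝ) / Real.sqrt n / π : ℝ) : ℂ) *
        ∫ y : ℝ, weilMellin g (1 / 2 + y * I) * ((Real.cos (y * Real.log n) : ℝ) : ℂ) := by
    intro n
    rw [integral_weilMellin_half_mul_cos' hgc hgs hI (Real.log n)]
    push_cast
    field_simp
  rw [Finset.sum_congr rfl fun n _ ↦ hterm n]
  -- the right-hand side as a finite sum
  have hint : ∀ n : ℕ, Integrable fun y : ℝ ↦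
      weilMellin g (1 / 2 + y * I) * ((Real.cos (y * Real.log n) : ℝ) : ℂ) := fun n ↦
    hI.mul_bdd (c := 1) (by fun_prop) (Eventually.of_forall fun y ↦ by
      rw [Complex.norm_real, Real.norm_eq_abs]; exact Real.abs_cos_le_one _)
  have hP : ∀ y : ℝ, weilMellin g (1 / 2 + y * I) * ((primeDensity X y : ℝ) : ℂ) =
      -∑ n ∈ s, (((Λ n : ℝ) / Real.sqrt n / π : ℝ) : ℂ) *
        (weilMellin g (1 / 2 + y * I) * ((Real.cos (y * Real.log n) : ℝ) : ℂ)) := by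
    intro y
    rw [primeDensity, ← hs, Complex.ofReal_mul, Complex.ofReal_sum, Finset.mul_sum, Finset.mul_sum,
      ← Finset.sum_neg_distrib]
    refine Finset.sum_congr rfl fun n _ ↦ ?_
    push_cast
    field_simp
  simp_rw [hP]
  rw [integral_neg, neg_neg, integral_finsetSum _ fun n _ ↦ (hint n).const_mul _]
  refine Finset.sum_congr rfl fun n _ ↦ ?_
  rw [integral_const_mul]

/-- **The archimedean term is `∫ ĝ μ`**: `(1/2π)∫ ĝ(½+it) Re ψ(¼+it/2) dt − g(0) log π
= ∫ ĝ(½+iy) μ(y) dy` (using `∫ ĝ(½+iy) dy = 2π g(0)`). [cite: AlpogeFurman2026, §2.1 eq. (2.2) (p. 4)] -/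
theorem weilArchTerm_eq_integral (hgc : Continuous g) (hgs : HasCompactSupport g)
    (hI : Integrable fun y : ℝ ↦ weilMellin g (1 / 2 + y * I))
    (hA : Integrable fun y : ℝ ↦ weilMellin g (1 / 2 + y * I) *
      ((Complex.digamma (1 / 4 + y / 2 * I)).re : ℂ)) :
    weilArchTerm g = ∫ y : ℝ, weilMellin g (1 / 2 + y * I) * ((archDensity y : ℝ) : ℂ) := by
  have hπ0 : (π : ℂ) ≠ 0 := Complex.ofReal_ne_zero.2 Real.pi_ne_zero
  have e : ∀ y : ℝ, weilMellin g (1 / 2 + y * I) * ((archDensity y : ℝ) : ℂ) =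
      (1 / (2 * π) : ℂ) * (weilMellin g (1 / 2 + y * I) * ((Complex.digamma (1 / 4 + y / 2 * I)).re : ℂ)) -
        weilMellin g (1 / 2 + y * I) * (Real.log π / (2 * π) : ℂ) := by
    intro y
    rw [archDensity]
    push_cast
    ring
  simp_rw [e]
  rw [integral_sub (hA.const_mul _) (hI.mul_const _), integral_const_mul, integral_mul_const,
    integral_weilMellin_half hgc hgs hI, weilArchTerm_eq]
  congr 1
  field_simp

/-- Integrability of `ĝ Π_X`, `ĝ P_X`, `ĝ μ` from that of `ĝ` and `ĝ · Re ψ`. [cite: AlpogeFurman2026, §2.1 eq. (2.2) (p. 4)] -/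
theorem integrable_mul_weilDensity_parts (hI : Integrable fun y : ℝ ↦ weilMellin g (1 / 2 + y * I))
    (hA : Integrable fun y : ℝ ↦ weilMellin g (1 / 2 + y * I) *
      ((Complex.digamma (1 / 4 + y / 2 * I)).re : ℂ)) (X : ℝ) :
    Integrable (fun y : ℝ ↦ weilMellin g (1 / 2 + y * I) * ((archDensity y : ℝ) : ℂ)) ∧
    Integrable (fun y : ℝ ↦ weilMellin g (1 / 2 + y * I) * ((polarDensity X y : ℝ) : ℂ)) ∧
    Integrable (fun y : ℝ ↦ weilMellin g (1 / 2 + y * I) * ((primeDensity X y : ℝ) : ℂ)) := by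
  refine ⟨?_, ?_, ?_⟩
  · have e : (fun y : ℝ ↦ weilMellin g (1 / 2 + y * I) * ((archDensity y : ℝ) : ℂ)) =
        fun y : ℝ ↦ (1 / (2 * π) : ℂ) * (weilMellin g (1 / 2 + y * I) *
          ((Complex.digamma (1 / 4 + y / 2 * I)).re : ℂ)) -
          weilMellin g (1 / 2 + y * I) * (Real.log π / (2 * π) : ℂ) := by
      funext y
      rw [archDensity]
      push_cast
      ring
    rw [e]
    exact (hA.const_mul _).sub (hI.mul_const _)
  · exact hI.mul_bdd (Complex.continuous_ofReal.comp (continuous_polarDensity X)).aestronglyMeasurable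
      (Eventually.of_forall fun y ↦ by
        rw [Complex.norm_real, Real.norm_eq_abs]; exact abs_polarDensity_le X y)
  · exact hI.mul_bdd (Complex.continuous_ofReal.comp (continuous_primeDensity X)).aestronglyMeasurable
      (Eventually.of_forall fun y ↦ by
        rw [Complex.norm_real, Real.norm_eq_abs]; exact abs_primeDensity_le X y)

/-- A continuous function with `tsupport g ⊆ [−A, A]` vanishes off `[−A, A]`. [folklore] -/
private theorem eq_zero_of_tsupport_subset {A : ℝ} (hsupp : tsupport g ⊆ Icc (-A) A) :
    (∀ u : ℝ, u < -A → g u = 0) ∧ (∀ u : ℝ, A < u → g u = 0) := by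
  constructor
  · intro u hu
    exact image_eq_zero_of_notMem_tsupport fun h ↦ by have := (hsupp h).1; linarith
  · intro u hu
    exact image_eq_zero_of_notMem_tsupport fun h ↦ by have := (hsupp h).2; linarith

end AlpogeFurman2026

open AlpogeFurman2026 in
/-- **[AF26] §2.1 eq. (2.2): Weil's explicit formula with the density `ν_X`.** Let `X ≥ 1` and let
`g : ℝ → ℂ` be continuous with `supp g ⊆ [−log X, log X]`, such that the zero side converges
absolutely (`Σ_ρ ‖m(ρ) ĝ(ρ)‖ < ∞`) and `y ↦ ĝ(½+iy)`, `y ↦ ĝ(½+iy) Re ψ(¼+iy/2)` are integrable.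
Then `Σ_ρ m(ρ) ĝ(ρ) = ∫ ĝ(½+iτ) ν_X(τ) dτ`, `ν_X = μ + Π_X + P_X` — the printed
"`Σ_ρ m_ρ F̂(γ_ρ) = ∫_ℝ F̂(τ) ν_X(τ) dτ` if `supp F ⊂ [−log X, log X]`" with `F̂(γ_s) = ĝ(s)`
(`γ_s = (s − ½)/i`; in the tree's normalisation `ĝ(s) = ∫ g(t) e^{(s−½)t} dt`, so `F = g(−·)`). The sum
is over all non-trivial zeros, each once, weighted by its multiplicity. PROVED from the tree's
Guinand–Weil formula for continuous test functions (`explicit_formula_continuous`) by evaluating the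
polar, prime and archimedean terms on the critical line. [cite: AlpogeFurman2026, §2.1 eq. (2.2) (p. 4)] -/
theorem AlpogeFurman2026_explicit_formula_nu {g : ℝ → ℂ} {X : ℝ} (hX : 1 ≤ X)
    (hgc : Continuous g) (hsupp : tsupport g ⊆ Icc (-Real.log X) (Real.log X))
    (hZ : Summable fun ρ : ZetaZeros.riemannZetaNontrivialZeros ↦
      ‖(riemannZetaZeroOrder (ρ : ℂ) : ℂ) * weilMellin g ρ‖)
    (hI : Integrable fun y : ℝ ↦ weilMellin g (1 / 2 + y * I))
    (hA : Integrable fun y : ℝ ↦ weilMellin g (1 / 2 + y * I) *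
      ((Complex.digamma (1 / 4 + y / 2 * I)).re : ℂ)) :
    ∑' ρ : ZetaZeros.riemannZetaNontrivialZeros, (riemannZetaZeroOrder (ρ : ℂ) : ℂ) * weilMellin g ρ =
      ∫ y : ℝ, weilMellin g (1 / 2 + y * I) * ((weilDensity X y : ℝ) : ℂ) := by
  have hgs : HasCompactSupport g :=
    IsCompact.of_isClosed_subset isCompact_Icc (isClosed_tsupport g) hsupp
  obtain ⟨hvan₁, hvan₂⟩ := eq_zero_of_tsupport_subset hsupp
  -- the tree's explicit formula, summed absolutely
  have hEF : HasWeilZeroSide g (weilFunctional g) := explicit_formula_continuous hgc hgs hZ hA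
  have hsum := hasWeilZeroSide_tsum hZ
  have heq : (∑' ρ : ZetaZeros.riemannZetaNontrivialZeros,
      (riemannZetaZeroOrder (ρ : ℂ) : ℂ) * weilMellin g ρ) = weilFunctional g :=
    tendsto_nhds_unique hsum hEF
  rw [heq, weilFunctional, weilPolarTerm_eq_integral hgc hgs hI hvan₁ hvan₂,
    weilPrimeTerm_eq_integral hgc hgs hI hX hvan₁ hvan₂, weilArchTerm_eq_integral hgc hgs hI hA,
    sub_neg_eq_add]
  obtain ⟨i1, i2, i3⟩ := integrable_mul_weilDensity_parts hI hA X
  have i23 : Integrable fun y : ℝ ↦ weilMellin g (1 / 2 + y * I) * ((polarDensity X y : ℝ) : ℂ) +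
      weilMellin g (1 / 2 + y * I) * ((primeDensity X y : ℝ) : ℂ) := i2.add i3
  rw [← integral_add i2 i3, ← integral_add i23 i1]
  congr 1 with y
  rw [weilDensity]
  push_cast
  ring

namespace AlpogeFurman2026

variable {ψ : ℝ → ℝ}

/-! ## §4. The modulated windows `φ e^{−iα·}` and their pair convolutions -/

/-- `γ_{½+iτ} = τ`: on the critical line the spectral parameter is the ordinate. [cite: AlpogeFurman2026, §1.2 (p. 2)] -/
theorem gammaOf_half_add_mul_I (τ : ℝ) : gammaOf (1 / 2 + τ * I) = τ := by
  rw [gammaOf, add_sub_cancel_left, mul_div_assoc, div_self Complex.I_ne_zero, mul_one]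

/-- For a non-trivial zero `ρ = β + iγ`: `γ_ρ = γ + i(½ − β)` with `|½ − β| ≤ ½`.
[cite: AlpogeFurman2026, §1.2 (p. 2)] -/
theorem gammaOf_eq_of_mem {ρ : ℂ} (hρ : ρ ∈ ZetaZeros.riemannZetaNontrivialZeros) :
    gammaOf ρ = (ρ.im : ℂ) + ((1 / 2 - ρ.re : ℝ) : ℂ) * I ∧ |1 / 2 - ρ.re| ≤ 1 / 2 := by
  have h0 := ZetaZeros.riemannZetaNontrivialZeros.re_pos hρ
  have h1 := ZetaZeros.riemannZetaNontrivialZeros.re_lt_one hρ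
  refine ⟨?_, abs_le.2 ⟨by linarith, by linarith⟩⟩
  apply Complex.ext
  · rw [(gammaOf_re_im ρ).1]; simp
  · rw [(gammaOf_re_im ρ).2]; simp

/-- **The modulated window** `φ_α(t) := φ(t) e^{−iαt}` (`φ = phi ψ T`, `α ∈ ℝ`), whose Weil
transform is `φ̂(γ_s − α)` (`weilMellin_phiMod`): the test vectors of [AF26] §2.2 are
`v_ρ = (φ̂(γ_ρ − α_k))_k`. [cite: AlpogeFurman2026, §2.2 eq. (2.9) (p. 4) and Lemma 2.1 (p. 5)] -/
def phiMod (ψ : ℝ → ℝ) (T α : ℝ) : ℝ → ℂ :=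
  fun t ↦ (phi ψ T t : ℂ) * cexp (-(I * α * t))

/-- `φ_α` is continuous. [cite: AlpogeFurman2026, §2.2 (p. 4)] -/
theorem continuous_phiMod (hψ : IsWindow ψ) (T α : ℝ) : Continuous (phiMod ψ T α) := by
  unfold phiMod
  exact (Complex.continuous_ofReal.comp (hψ.continuous_phi T)).mul (by fun_prop)

/-- `φ_α` has compact support. [cite: AlpogeFurman2026, §2.2 (p. 4)] -/
theorem hasCompactSupport_phiMod (ψ : ℝ → ℝ) (T α : ℝ) : HasCompactSupport (phiMod ψ T α) :=
  ((hasCompactSupport_phi ψ T).comp_left Complex.ofReal_zero).mul_right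

/-- `supp φ_α ⊆ (−L/2, L/2)`. [cite: AlpogeFurman2026, §2.2 (p. 4)] -/
theorem support_phiMod_subset (ψ : ℝ → ℝ) (T α : ℝ) :
    Function.support (phiMod ψ T α) ⊆ Ioo (-(logHeight T / 2)) (logHeight T / 2) := by
  intro t ht
  apply support_phi_subset ψ T
  rw [Function.mem_support] at ht ⊢
  intro h
  apply ht
  simp [phiMod, h]

/-- **`(φ_α)^(s) = φ̂(γ_s − α)`** for every `s ∈ ℂ` (`φ` even; `iγ_s = s − ½`).
[cite: AlpogeFurman2026, Lemma 2.1 (p. 5)] -/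
theorem weilMellin_phiMod (hψ : IsWindow ψ) (T α : ℝ) (s : ℂ) :
    weilMellin (phiMod ψ T α) s = hat (fun u ↦ (phi ψ T u : ℂ)) (gammaOf s - α) := by
  rw [show gammaOf s - (α : ℂ) = -((α : ℂ) - gammaOf s) by ring, hat_neg_of_even (phi_neg hψ.even T)]
  simp only [weilMellin, hat, phiMod]
  refine integral_congr_ae (Eventually.of_forall fun u ↦ ?_)
  dsimp only
  rw [mul_assoc, ← Complex.exp_add]
  congr 2
  rw [gammaOf]
  have hI : I ≠ 0 := Complex.I_ne_zero
  field_simp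
  ring_nf

/-- **The pair test function** `g_{α,α′} := φ_α ⋆ φ_{α′}`, whose Weil transform is
`φ̂(γ_s − α) φ̂(γ_s − α′)`; applied at the grid points it produces the entries of `G̃ + Ẽ`
([AF26] (2.11)). [cite: AlpogeFurman2026, §2.3 eq. (2.11) (pp. 4–5)] -/
def pairTest (ψ : ℝ → ℝ) (T α α' : ℝ) : ℝ → ℂ :=
  weilConv (phiMod ψ T α) (phiMod ψ T α')

/-- `g_{α,α′}` is continuous. [cite: AlpogeFurman2026, §2.2 (p. 4)] -/
theorem continuous_pairTest (hψ : IsWindow ψ) (T α α' : ℝ) : Continuous (pairTest ψ T α α') := by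
  unfold pairTest weilConv
  exact (hasCompactSupport_phiMod ψ T α').continuous_convolution_right _
    ((continuous_phiMod hψ T α).locallyIntegrable) (continuous_phiMod hψ T α')

/-- `g_{α,α′}` has compact support. [cite: AlpogeFurman2026, §2.2 (p. 4)] -/
theorem hasCompactSupport_pairTest (ψ : ℝ → ℝ) (T α α' : ℝ) :
    HasCompactSupport (pairTest ψ T α α') := by
  unfold pairTest weilConv
  exact (hasCompactSupport_phiMod ψ T α).convolution _ (hasCompactSupport_phiMod ψ T α')

/-- `supp g_{α,α′} ⊆ (−L, L)`, hence `⊆ [−log X, log X]` with `X = e^L = T/2π`.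
[cite: AlpogeFurman2026, §2.2 (p. 4)] -/
theorem tsupport_pairTest_subset (ψ : ℝ → ℝ) (T α α' : ℝ) :
    tsupport (pairTest ψ T α α') ⊆ Icc (-logHeight T) (logHeight T) := by
  have h1 : Function.support (pairTest ψ T α α') ⊆ Ioo (-logHeight T) (logHeight T) := by
    refine (support_convolution_subset _).trans ?_
    rw [Set.add_subset_iff]
    intro x hx y hy
    have hx' := support_phiMod_subset ψ T α hx
    have hy' := support_phiMod_subset ψ T α' hy
    exact ⟨by linarith [hx'.1, hy'.1], by linarith [hx'.2, hy'.2]⟩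
  exact (closure_mono h1).trans (isClosed_Icc.closure_subset_iff.2 Ioo_subset_Icc_self)

/-- **`ĝ_{α,α′}(s) = φ̂(γ_s − α) φ̂(γ_s − α′)`**. [cite: AlpogeFurman2026, §2.3 eq. (2.11) (pp. 4–5)] -/
theorem weilMellin_pairTest (hψ : IsWindow ψ) (T α α' : ℝ) (s : ℂ) :
    weilMellin (pairTest ψ T α α') s =
      hat (fun u ↦ (phi ψ T u : ℂ)) (gammaOf s - α) * hat (fun u ↦ (phi ψ T u : ℂ)) (gammaOf s - α') := by
  rw [pairTest, weilMellin_weilConv_holds (continuous_phiMod hψ T α) (hasCompactSupport_phiMod ψ T α)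
    (continuous_phiMod hψ T α') (hasCompactSupport_phiMod ψ T α'), weilMellin_phiMod hψ,
    weilMellin_phiMod hψ]

/-! ### Uniform decay of `φ̂` in the strip `|Im z| ≤ ½` -/

/-- The trivial bound `‖φ̂(ξ + iy)‖ ≤ e^{L/4} ∫ φ` for `|y| ≤ ½` (`φ ≥ 0` lives on `|u| < L/2`).
[cite: AlpogeFurman2026, §2.2 eq. (2.8) (p. 4)] -/
theorem norm_hat_phi_le_trivial (hψ : IsWindow ψ) (T : ℝ) {y : ℝ}
    (hy : |y| ≤ 1 / 2) (ξ : ℝ) :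
    ‖hat (fun u ↦ (phi ψ T u : ℂ)) ((ξ : ℂ) + (y : ℂ) * I)‖ ≤
      Real.exp (logHeight T / 4) * ∫ u : ℝ, phi ψ T u := by
  rw [hat_ofReal_add_mul_I, hat]
  refine (norm_integral_le_integral_norm _).trans ?_
  rw [← integral_const_mul]
  refine integral_mono_of_nonneg (Eventually.of_forall fun u ↦ norm_nonneg _) ?_
    (Eventually.of_forall fun u ↦ ?_)
  · exact ((hψ.continuous_phi T).integrable_of_hasCompactSupport (hasCompactSupport_phi ψ T)).const_mul _
  · dsimp only
    rw [norm_mul, Complex.norm_exp, Complex.norm_real, Real.norm_eq_abs]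
    have hre : (-(I * (ξ : ℂ) * (u : ℂ))).re = 0 := by simp
    rw [hre, Real.exp_zero, mul_one]
    by_cases hu : phi ψ T u = 0
    · rw [hu]; simp
    · have hmem := support_phi_subset ψ T (Function.mem_support.2 hu)
      rw [abs_mul, abs_of_nonneg (phi_nonneg ψ T u), abs_of_pos (Real.exp_pos _), mul_comm]
      refine mul_le_mul_of_nonneg_right (Real.exp_le_exp.2 ?_) (phi_nonneg ψ T u)
      have : |u| < logHeight T / 2 := abs_lt.2 ⟨hmem.1, hmem.2⟩
      have h1 : y * u ≤ |y| * |u| := by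
        rw [← abs_mul]; exact le_abs_self _
      nlinarith [abs_nonneg y, abs_nonneg u]

/-- **Uniform first-order decay in the strip**: for a window and `L ≥ 10` there is `D` with
`‖φ̂(ξ + iy)‖ ≤ D/(1 + |ξ|)` for all real `ξ` and `|y| ≤ ½` (the tree's `norm_hat_phi_le` for `|ξ| ≥ 1`,
the trivial bound for `|ξ| < 1`). [cite: AlpogeFurman2026, §2.2 eq. (2.8) (p. 4)] -/
theorem exists_norm_hat_phi_le_strip (hψ : IsWindow ψ) {T : ℝ} (hL : 10 ≤ logHeight T) :
    ∃ D : ℝ, 0 ≤ D ∧ ∀ (ξ y : ℝ), |y| ≤ 1 / 2 →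
      ‖hat (fun u ↦ (phi ψ T u : ℂ)) ((ξ : ℂ) + (y : ℂ) * I)‖ ≤ D / (1 + |ξ|) := by
  obtain ⟨m₀, B, K, hm₀, hB0, hK0, -, hB, hK⟩ := hψ.exists_bounds
  obtain ⟨Kχ, hKχ0, hKχ⟩ := exists_lipschitz_smoothRamp
  set C : ℝ := π / 2 * Real.exp (π / 2) * (B + K + 4 * (1 + π) * Kχ * B) with hC
  have hC0 : 0 ≤ C := by rw [hC]; positivity
  set A : ℝ := Real.exp (logHeight T / 4) * ∫ u : ℝ, phi ψ T u with hA
  have hA0 : 0 ≤ A := mul_nonneg (Real.exp_nonneg _) (integral_nonneg fun u ↦ phi_nonneg ψ T u)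
  have hL0 : 0 < logHeight T := by linarith
  refine ⟨2 * max A (C * Real.exp (logHeight T / 4)), by positivity, fun ξ y hy ↦ ?_⟩
  have hM0 : 0 ≤ max A (C * Real.exp (logHeight T / 4)) := le_max_of_le_left hA0
  rcases lt_or_ge |ξ| 1 with hξ | hξ
  · have h := norm_hat_phi_le_trivial hψ T hy ξ
    rw [le_div_iff₀ (by positivity)]
    calc ‖hat (fun u ↦ (phi ψ T u : ℂ)) ((ξ : ℂ) + (y : ℂ) * I)‖ * (1 + |ξ|)
        ≤ A * 2 := mul_le_mul h (by linarith) (by positivity) hA0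
      _ ≤ 2 * max A (C * Real.exp (logHeight T / 4)) := by linarith [le_max_left A (C * Real.exp (logHeight T / 4))]
  · have h := norm_hat_phi_le hψ hB0 hK0 hKχ0 hB hK hKχ hL hy hξ
    have hexp : Real.exp (logHeight T * |y| / 2) ≤ Real.exp (logHeight T / 4) :=
      Real.exp_le_exp.2 (by nlinarith [abs_nonneg y])
    have hξ0 : 0 < |ξ| := by linarith
    rw [le_div_iff₀ (by positivity)]
    calc ‖hat (fun u ↦ (phi ψ T u : ℂ)) ((ξ : ℂ) + (y : ℂ) * I)‖ * (1 + |ξ|)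
        ≤ C * Real.exp (logHeight T * |y| / 2) / |ξ| * (1 + |ξ|) :=
          mul_le_mul_of_nonneg_right h (by positivity)
      _ ≤ C * Real.exp (logHeight T / 4) / |ξ| * (2 * |ξ|) := by
          refine mul_le_mul ?_ (by linarith) (by positivity) (by positivity)
          exact div_le_div_of_nonneg_right (mul_le_mul_of_nonneg_left hexp hC0) hξ0.le
      _ = 2 * (C * Real.exp (logHeight T / 4)) := by field_simp
      _ ≤ 2 * max A (C * Real.exp (logHeight T / 4)) := by
          linarith [le_max_right A (C * Real.exp (logHeight T / 4))]

/-- **Decay of the pair transform in the strip**: there is `K` with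
`‖φ̂((ξ−α) + iy) φ̂((ξ−α′) + iy)‖ ≤ K/(1 + ξ²)` for all real `ξ` and `|y| ≤ ½`.
[cite: AlpogeFurman2026, §2.2 eq. (2.8) (p. 4)] -/
theorem exists_norm_hat_pair_le (hψ : IsWindow ψ) {T : ℝ} (hL : 10 ≤ logHeight T) (α α' : ℝ) :
    ∃ K : ℝ, 0 ≤ K ∧ ∀ (ξ y : ℝ), |y| ≤ 1 / 2 →
      ‖hat (fun u ↦ (phi ψ T u : ℂ)) (((ξ - α : ℝ) : ℂ) + (y : ℂ) * I) *
        hat (fun u ↦ (phi ψ T u : ℂ)) (((ξ - α' : ℝ) : ℂ) + (y : ℂ) * I)‖ ≤ K / (1 + ξ ^ 2) := by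
  obtain ⟨D, hD0, hD⟩ := exists_norm_hat_phi_le_strip hψ hL
  refine ⟨D ^ 2 * ((1 + |α|) * (1 + |α'|)), by positivity, fun ξ y hy ↦ ?_⟩
  have h1 := hD (ξ - α) y hy
  have h2 := hD (ξ - α') y hy
  rw [norm_mul]
  -- `(1 + |ξ|) ≤ (1 + |ξ − a|)(1 + |a|)`
  have htri : ∀ a : ℝ, 1 + |ξ| ≤ (1 + |ξ - a|) * (1 + |a|) := by
    intro a
    have := abs_sub_abs_le_abs_sub ξ a
    nlinarith [abs_nonneg (ξ - a), abs_nonneg a, abs_nonneg ξ]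
  have hsq : 1 + ξ ^ 2 ≤ (1 + |ξ|) ^ 2 := by nlinarith [abs_nonneg ξ, sq_abs ξ]
  calc ‖hat (fun u ↦ (phi ψ T u : ℂ)) (((ξ - α : ℝ) : ℂ) + (y : ℂ) * I)‖ *
        ‖hat (fun u ↦ (phi ψ T u : ℂ)) (((ξ - α' : ℝ) : ℂ) + (y : ℂ) * I)‖
      ≤ D / (1 + |ξ - α|) * (D / (1 + |ξ - α'|)) :=
        mul_le_mul h1 h2 (norm_nonneg _) (by positivity)
    _ = D ^ 2 / ((1 + |ξ - α|) * (1 + |ξ - α'|)) := by field_simp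
    _ ≤ D ^ 2 / ((1 + ξ ^ 2) / ((1 + |α|) * (1 + |α'|))) := by
        refine div_le_div_of_nonneg_left (by positivity) (by positivity) ?_
        rw [div_le_iff₀ (by positivity)]
        calc 1 + ξ ^ 2 ≤ (1 + |ξ|) ^ 2 := hsq
          _ = (1 + |ξ|) * (1 + |ξ|) := sq _
          _ ≤ ((1 + |ξ - α|) * (1 + |α|)) * ((1 + |ξ - α'|) * (1 + |α'|)) :=
              mul_le_mul (htri α) (htri α') (by positivity) (by positivity)
          _ = (1 + |ξ - α|) * (1 + |ξ - α'|) * ((1 + |α|) * (1 + |α'|)) := by ring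
    _ = D ^ 2 * ((1 + |α|) * (1 + |α'|)) / (1 + ξ ^ 2) := by field_simp

/-! ### The three analytic hypotheses of the explicit formula for `g_{α,α′}` -/

/-- `Σ_ρ m(ρ)/(1+γ²) < ∞` over the non-trivial zeros, in the `ZetaZeros` vocabulary (the tree's
`ZetaZeroSum.summable_zeroOrder_div_one_add_sq`). [cite: AlpogeFurman2026, Proposition 4.3 (p. 7)] -/
theorem summable_zeroOrder_div_one_add_im_sq :
    Summable fun ρ : ZetaZeros.riemannZetaNontrivialZeros ↦
      (riemannZetaZeroOrder (ρ : ℂ) : ℝ) / (1 + (ρ : ℂ).im ^ 2) :=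
  ZetaZeroSum.summable_zeroOrder_div_one_add_sq

/-- **Absolute convergence of the zero side for `g_{α,α′}`**:
`Σ_ρ m(ρ) |φ̂(γ_ρ − α) φ̂(γ_ρ − α′)| < ∞` (decay `≪ 1/(1+γ²)` in the strip against
`Σ m(ρ)/(1+γ²) < ∞`). [cite: AlpogeFurman2026, §2.3 eq. (2.11) (pp. 4–5)] -/
theorem summable_pairTest_zeros (hψ : IsWindow ψ) {T : ℝ} (hL : 10 ≤ logHeight T) (α α' : ℝ) :
    Summable fun ρ : ZetaZeros.riemannZetaNontrivialZeros ↦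
      ‖(riemannZetaZeroOrder (ρ : ℂ) : ℂ) * weilMellin (pairTest ψ T α α') ρ‖ := by
  obtain ⟨K, hK0, hK⟩ := exists_norm_hat_pair_le hψ hL α α'
  refine Summable.of_nonneg_of_le (fun _ ↦ norm_nonneg _) (fun ρ ↦ ?_)
    (summable_zeroOrder_div_one_add_im_sq.mul_left K)
  obtain ⟨hγ, hy⟩ := gammaOf_eq_of_mem ρ.2
  have hm : (0 : ℝ) ≤ riemannZetaZeroOrder (ρ : ℂ) := by
    exact_mod_cast riemannZetaZeroOrder_nonneg (ZetaZeros.riemannZetaNontrivialZeros.ne_one ρ.2)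
  rw [norm_mul, Complex.norm_intCast, abs_of_nonneg hm, weilMellin_pairTest hψ, hγ]
  have e1 : ((ρ : ℂ).im : ℂ) + ((1 / 2 - (ρ : ℂ).re : ℝ) : ℂ) * I - α =
      (((ρ : ℂ).im - α : ℝ) : ℂ) + ((1 / 2 - (ρ : ℂ).re : ℝ) : ℂ) * I := by push_cast; ring
  have e2 : ((ρ : ℂ).im : ℂ) + ((1 / 2 - (ρ : ℂ).re : ℝ) : ℂ) * I - α' =
      (((ρ : ℂ).im - α' : ℝ) : ℂ) + ((1 / 2 - (ρ : ℂ).re : ℝ) : ℂ) * I := by push_cast; ring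
  rw [e1, e2]
  have h := hK (ρ : ℂ).im (1 / 2 - (ρ : ℂ).re) hy
  calc (riemannZetaZeroOrder (ρ : ℂ) : ℝ) * _ ≤ (riemannZetaZeroOrder (ρ : ℂ) : ℝ) * (K / (1 + (ρ : ℂ).im ^ 2)) :=
        mul_le_mul_of_nonneg_left h hm
    _ = K * ((riemannZetaZeroOrder (ρ : ℂ) : ℝ) / (1 + (ρ : ℂ).im ^ 2)) := by ring

/-- On the critical line `ĝ_{α,α′}(½+iy) = φ̂(y − α) φ̂(y − α′)`. [cite: AlpogeFurman2026, §2.3 eq. (2.11) (pp. 4–5)] -/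
theorem weilMellin_pairTest_half (hψ : IsWindow ψ) (T α α' y : ℝ) :
    weilMellin (pairTest ψ T α α') (1 / 2 + y * I) =
      hat (fun u ↦ (phi ψ T u : ℂ)) ((y : ℂ) - α) * hat (fun u ↦ (phi ψ T u : ℂ)) ((y : ℂ) - α') := by
  rw [weilMellin_pairTest hψ, gammaOf_half_add_mul_I]

/-- `‖ĝ_{α,α′}(½+iy)‖ ≤ K/(1+y²)` with the constant of `exists_norm_hat_pair_le`. [cite: AlpogeFurman2026, §2.3 eq. (2.11) (pp. 4–5)] -/
theorem norm_weilMellin_pairTest_half_le (hψ : IsWindow ψ) {T : ℝ} {α α' K : ℝ}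
    (hK : ∀ (ξ y : ℝ), |y| ≤ 1 / 2 →
      ‖hat (fun u ↦ (phi ψ T u : ℂ)) (((ξ - α : ℝ) : ℂ) + (y : ℂ) * I) *
        hat (fun u ↦ (phi ψ T u : ℂ)) (((ξ - α' : ℝ) : ℂ) + (y : ℂ) * I)‖ ≤ K / (1 + ξ ^ 2)) (y : ℝ) :
    ‖weilMellin (pairTest ψ T α α') (1 / 2 + y * I)‖ ≤ K / (1 + y ^ 2) := by
  have h := hK y 0 (by norm_num)
  rw [weilMellin_pairTest_half hψ]
  have e1 : ((y : ℂ) - α) = (((y - α : ℝ)) : ℂ) + ((0 : ℝ) : ℂ) * I := by push_cast; ring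
  have e2 : ((y : ℂ) - α') = (((y - α' : ℝ)) : ℂ) + ((0 : ℝ) : ℂ) * I := by push_cast; ring
  rw [e1, e2]
  exact h

/-- **`y ↦ ĝ_{α,α′}(½+iy)` is integrable.** [cite: AlpogeFurman2026, §2.3 eq. (2.11) (pp. 4–5)] -/
theorem integrable_pairTest_half (hψ : IsWindow ψ) {T : ℝ} (hL : 10 ≤ logHeight T) (α α' : ℝ) :
    Integrable fun y : ℝ ↦ weilMellin (pairTest ψ T α α') (1 / 2 + y * I) := by
  obtain ⟨K, hK0, hK⟩ := exists_norm_hat_pair_le hψ hL α α'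
  have hc : Continuous fun y : ℝ ↦ weilMellin (pairTest ψ T α α') (1 / 2 + y * I) :=
    (continuous_weilMellin (continuous_pairTest hψ T α α') (hasCompactSupport_pairTest ψ T α α')).comp
      (by fun_prop)
  refine Integrable.mono' (integrable_inv_one_add_sq.const_mul K) hc.aestronglyMeasurable
    (Eventually.of_forall fun y ↦ ?_)
  rw [← div_eq_mul_inv]
  exact norm_weilMellin_pairTest_half_le hψ hK y

/-- `log 4 ≤ 2`. [folklore] -/
private theorem log_four_le_two : Real.log 4 ≤ 2 := by
  rw [show (4 : ℝ) = 2 ^ 2 by norm_num, Real.log_pow]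
  have := Real.log_two_lt_d9
  push_cast
  linarith

/-- The archimedean weight against the decay `1/(1+τ²)` is dominated by an integrable power:
`(log(3+|τ|) + 12)/(1+τ²) ≤ 14 (1+τ²)^{−3/4}`. [folklore] -/
private theorem log_weight_le (τ : ℝ) :
    (Real.log (3 + |τ|) + 12) / (1 + τ ^ 2) ≤ 14 * (1 + ‖τ‖ ^ 2) ^ (-(3 / 2 : ℝ) / 2) := by
  rw [Real.norm_eq_abs, sq_abs]
  set v : ℝ := 1 + τ ^ 2 with hv
  have hv1 : 1 ≤ v := by rw [hv]; nlinarith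
  have hv0 : 0 < v := by linarith
  set u : ℝ := v ^ (1 / 4 : ℝ) with hu
  have hu1 : 1 ≤ u := Real.one_le_rpow hv1 (by norm_num)
  have hu0 : 0 < u := by linarith
  -- `u² = √v ≥ |τ|`
  have hu2 : u ^ 2 = Real.sqrt v := by
    rw [hu, ← Real.rpow_natCast, ← Real.rpow_mul hv0.le, Real.sqrt_eq_rpow]
    norm_num
  have hτ : |τ| ≤ u ^ 2 := by
    rw [hu2]
    refine Real.abs_le_sqrt ?_
    rw [hv]; linarith
  -- `v^{-3/4} = u/v`
  have hpow : v ^ (-(3 / 2 : ℝ) / 2) = u / v := by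
    rw [hu, show (-(3 / 2 : ℝ) / 2) = 1 / 4 - 1 by norm_num, Real.rpow_sub hv0, Real.rpow_one]
  rw [hpow, div_le_iff₀ hv0, show 14 * (u / v) * v = 14 * u by field_simp]
  -- `log(3 + |τ|) ≤ log(4u²) = log 4 + 2 log u ≤ 2 + 2(u - 1) = 2u`
  have h1 : 3 + |τ| ≤ 4 * u ^ 2 := by nlinarith
  have h2 : Real.log (3 + |τ|) ≤ Real.log (4 * u ^ 2) :=
    Real.log_le_log (by positivity) h1
  have h3 : Real.log (4 * u ^ 2) = Real.log 4 + 2 * Real.log u := by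
    rw [Real.log_mul (by norm_num) (by positivity), Real.log_pow]; push_cast; ring
  have h4 : Real.log u ≤ u - 1 := Real.log_le_sub_one_of_pos hu0
  linarith [log_four_le_two]

/-- **`y ↦ ĝ_{α,α′}(½+iy) Re ψ(¼+iy/2)` is integrable** (`|Re ψ(¼+iy/2)| ≤ log(3+|y|) + 12`, tree
lemma `abs_re_digamma_quarter_le_log`). [cite: AlpogeFurman2026, §2.3 eq. (2.11) (pp. 4–5)] -/
theorem integrable_pairTest_half_mul_digamma (hψ : IsWindow ψ) {T : ℝ} (hL : 10 ≤ logHeight T)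
    (α α' : ℝ) :
    Integrable fun y : ℝ ↦ weilMellin (pairTest ψ T α α') (1 / 2 + y * I) *
      ((Complex.digamma (1 / 4 + y / 2 * I)).re : ℂ) := by
  obtain ⟨K, hK0, hK⟩ := exists_norm_hat_pair_le hψ hL α α'
  have hc : Continuous fun y : ℝ ↦ weilMellin (pairTest ψ T α α') (1 / 2 + y * I) *
      ((Complex.digamma (1 / 4 + y / 2 * I)).re : ℂ) :=
    ((continuous_weilMellin (continuous_pairTest hψ T α α') (hasCompactSupport_pairTest ψ T α α')).comp
      (by fun_prop)).mul (Complex.continuous_ofReal.comp continuous_re_digamma_quarter_half)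
  have hmaj : Integrable fun y : ℝ ↦ K * (14 * (1 + ‖y‖ ^ 2) ^ (-(3 / 2 : ℝ) / 2)) :=
    ((integrable_rpow_neg_one_add_norm_sq (E := ℝ) (by simp; norm_num)).const_mul 14).const_mul K
  refine Integrable.mono' hmaj hc.aestronglyMeasurable (Eventually.of_forall fun y ↦ ?_)
  rw [norm_mul, Complex.norm_real, Real.norm_eq_abs]
  have h1 := norm_weilMellin_pairTest_half_le hψ hK y
  have h2 := abs_re_digamma_quarter_le_log y
  have h3 := log_weight_le y
  calc ‖weilMellin (pairTest ψ T α α') (1 / 2 + y * I)‖ * |(digamma (1 / 4 + y / 2 * I)).re|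
      ≤ K / (1 + y ^ 2) * (Real.log (3 + |y|) + 12) :=
        mul_le_mul h1 h2 (abs_nonneg _) (by positivity)
    _ = K * ((Real.log (3 + |y|) + 12) / (1 + y ^ 2)) := by ring
    _ ≤ K * (14 * (1 + ‖y‖ ^ 2) ^ (-(3 / 2 : ℝ) / 2)) := mul_le_mul_of_nonneg_left h3 hK0

end AlpogeFurman2026

/-! ## §5. [AF26] (2.11): the entries of `G̃ + Ẽ` as integrals against `ν_X` -/

open AlpogeFurman2026 in
/-- **[AF26] §2.3 eq. (2.11), the compressed form on the prime side.** For a window `ψ`, a height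
`T ≥ 2π` with `L = log(T/2π) ≥ 10`, and any real `α, α′`,
`Σ_ρ m_ρ φ̂(γ_ρ − α) φ̂(γ_ρ − α′) = ∫_ℝ φ̂(τ − α) φ̂(τ − α′) ν_X(τ) dτ` with `X = e^L = T/2π`, the sum
over ALL non-trivial zeros (each once, weighted by multiplicity; absolutely convergent,
`summable_pairTest_zeros`). At the grid points `α = α_k`, `α′ = α_{k′}` and after multiplication by
`(aL²)⁻¹` the left side is the printed `(G̃ + Ẽ)_{kk′}` — the part over `Re γ_ρ ∈ I′` being the entry
`(gramMatrix ψ T)_{kk′}` of the typed model — and the identity is the printed (2.11), i.e. (2.2)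
applied to `F̂(τ) = φ̂(τ − α_k) φ̂(τ − α_{k′})`. PROVED (Weil's explicit formula for the pair test
function `φ_α ⋆ φ_{α′}`). [cite: AlpogeFurman2026, §2.3 eq. (2.11) (pp. 4–5)] -/
theorem AlpogeFurman2026_gram_entry_formula {ψ : ℝ → ℝ} (hψ : IsWindow ψ) {T : ℝ}
    (hT : 2 * π ≤ T) (hL : 10 ≤ logHeight T) (α α' : ℝ) :
    ∑' ρ : ZetaZeros.riemannZetaNontrivialZeros, (riemannZetaZeroOrder (ρ : ℂ) : ℂ) *
        (hat (fun u ↦ (phi ψ T u : ℂ)) (gammaOf ρ - α) * hat (fun u ↦ (phi ψ T u : ℂ)) (gammaOf ρ - α')) =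
      ∫ τ : ℝ, hat (fun u ↦ (phi ψ T u : ℂ)) ((τ : ℂ) - α) * hat (fun u ↦ (phi ψ T u : ℂ)) ((τ : ℂ) - α') *
        ((weilDensity (T / (2 * π)) τ : ℝ) : ℂ) := by
  have hπ := Real.pi_pos
  have hX : 1 ≤ T / (2 * π) := by rwa [le_div_iff₀ (by positivity), one_mul]
  have h := AlpogeFurman2026_explicit_formula_nu hX (continuous_pairTest hψ T α α')
    (tsupport_pairTest_subset ψ T α α') (summable_pairTest_zeros hψ hL α α')
    (integrable_pairTest_half hψ hL α α') (integrable_pairTest_half_mul_digamma hψ hL α α')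
  simp_rw [weilMellin_pairTest hψ, gammaOf_half_add_mul_I] at h
  exact h

open AlpogeFurman2026 in
/-- The entries of the typed `G̃`: `(gramMatrix ψ T)_{kk′} = (aL²)⁻¹ Σ_{Re γ_ρ ∈ I′} m_ρ φ̂(γ_ρ − α_k) φ̂(γ_ρ − α_{k′})`
(unfolding `v_ρ v_ρᵀ`), the near-window part of the sum in `AlpogeFurman2026_gram_entry_formula`.
[cite: AlpogeFurman2026, §2.3 eq. (2.10)–(2.11) (pp. 4–5)] -/
theorem AlpogeFurman2026.gramMatrix_apply (ψ : ℝ → ℝ) (T : ℝ) (k k' : Fin (gridDim T)) :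
    gramMatrix ψ T k k' = gramWeight ψ T * ∑ ρ ∈ nearZeroFinset T, (riemannZetaZeroOrder ρ : ℂ) *
      (hat (fun u ↦ (phi ψ T u : ℂ)) (gammaOf ρ - (grid T (logHeight T) ((k : ℕ) : ℤ) : ℂ)) *
        hat (fun u ↦ (phi ψ T u : ℂ)) (gammaOf ρ - (grid T (logHeight T) ((k' : ℕ) : ℤ) : ℂ))) := by
  rw [gramMatrix_eq_sum, Matrix.smul_apply, Matrix.sum_apply, smul_eq_mul]
  congr 1

end Literature.NumberTheory.LFunctions

end
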